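import Summits.HubbardSuperconductivity.HubbardSuperconductivity.Theorems.AnisotropyChordTransferFibre3FinGradCell
import Summits.HubbardSuperconductivity.HubbardSuperconductivity.Theorems.AnisotropyChordTransferFibre3OneLoopCross
import Summits.HubbardSuperconductivity.HubbardSuperconductivity.Theorems.AnisotropyChordTransferFibre3KernelHarmonicity

/-!
# Route `AnisotropyChord` / H0 rotor rung: FIN layer 2c — the CONVOLUTION form of `S = Σ Π⁰·C0fn` and `N = ‖Π⁰‖²` on a λ-cell

The symmetric-group folding of the twelve-term cross sum (p1 `cross_sum_w`, `piR_mul_C0fn`): for an even, swap-symmetric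
two-magnon profile `f`,
  `Σ_c Π⁰(c)·C0fn(c) = −6 · Σ_x φ(x) Σ_y φ(y) f(y−x)²`,  `φ = f·D_{ex} f`   (`sum_piR_C0fn_conv`),
  `‖Π⁰‖² = Σ_x F(x) Σ_y F(y) F(y−x)`,  `F = f²`   (`piNormSq_conv`),
and an interval evaluator of such convolution triples by ROW DOT PRODUCTS (`dot`, `rowConv`, `convIv`: the inner sum over
`y₂` walks the row of `φ` against the cyclically rotated row of `F`, so that every table entry is reached in `O(1)` amortised
kernel steps) with its soundness (`mem_convIv`), the tables `phiTab`, `fsqTab`, the one-direction gradient oracle `cellOracle1`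
and ★ `mem_SIv3`, `mem_NIv3`. Cost per cell `≈ 4V²` interval products (the FIN layer 2b evaluator: `≈ 35V²`), which moves the
single-fact reach of the regime certificate from `L = 9` to `L ≈ 15` (`…Fibre3FinMHoleConv`).
Prover seat `hubbard-h0-rotor-p3` g4; helper for stmt-HubbardSuperconductivity-23918 (piece A of rung 19089; `--supports`, helper class).
WHAT THIS IS NOT: nothing here proves superconductivity in the Hubbard model; evaluator definitions and their enclosure lemmas only.
Tree imports only; no sorry.
-/

set_option linter.dupNamespace false
set_option autoImplicit false

noncomputable section

namespace Summit.HubbardSuperconductivity.HubbardSuperconductivity.Theorems.AnisotropyChord.Transfer.Fibre3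

namespace FinCell

open scoped BigOperators
open Finset Hole2

variable (L : ℕ) [NeZero L]

/-! ## Layer 2c: the convolution evaluator (computable, zero data) -/

/-- the interval dot product of two rows (truncated to the shorter). [folklore] -/
def dot : List Iv → List Iv → Iv
  | a :: as, b :: bs => iadd (imul a b) (dot as bs)
  | _, _ => (0, 0)

/-- an `L × L` table from a function of natural coordinates. [folklore] -/
def mkTab (L : ℕ) (g : ℕ → ℕ → Iv) : List (List Iv) :=
  (List.range L).map fun r1 => (List.range L).map fun r2 => g r1 r2

/-- the inner row sum `Σ_{y₂} φ(y₁,y₂)·F(y₁−x₁, y₂−x₂)`: the row of `φ` against the rotated row of `F`. [folklore] -/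
def rowConv (L : ℕ) (pt Ft : List (List Iv)) (x1 x2 y1 : ℕ) : Iv :=
  dot (pt.getD y1 []) ((Ft.getD (subm L y1 x1) []).rotate (L - x2))

/-- the convolution triple `Σ_x φ(x)·Σ_y φ(y)·F(y−x)`. [folklore] -/
def convIv (L : ℕ) (pt Ft : List (List Iv)) : Iv :=
  psum (fun x1 => psum (fun x2 => imul (getF pt x1 x2) (psum (fun y1 => rowConv L pt Ft x1 x2 y1) L)) L) L

/-- the table of `φ = f·D_{ex} f` from the profile table and a gradient oracle. [folklore] -/
def phiTab (L : ℕ) (ft : List (List Iv)) (dF : ℕ → ℕ → ℕ → ℕ → Iv) : List (List Iv) :=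
  mkTab L fun r1 r2 => imul (getF ft r1 r2) (dF 1 0 r1 r2)

/-- the table of `F = f²`. [folklore] -/
def fsqTab (L : ℕ) (ft : List (List Iv)) : List (List Iv) :=
  mkTab L fun r1 r2 => imul (getF ft r1 r2) (getF ft r1 r2)

/-- ★ `S = Σ_c Π⁰·C0fn = −6·Σ_x φ(x) Σ_y φ(y) F(y−x)` on the cell. [folklore] -/
def SIv3 (L : ℕ) (ft : List (List Iv)) (dF : ℕ → ℕ → ℕ → ℕ → Iv) : Iv :=
  ineg (iscale 6 (convIv L (phiTab L ft dF) (fsqTab L ft)))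

/-- ★ `N = ‖Π⁰‖² = Σ_x F(x) Σ_y F(y) F(y−x)` on the cell. [folklore] -/
def NIv3 (L : ℕ) (ft : List (List Iv)) : Iv :=
  convIv L (fsqTab L ft) (fsqTab L ft)

/-- the one-direction gradient oracle: the `ex` table, direct evaluation otherwise (never reached by `SIv3`). [folklore] -/
def dOracle1 (L : ℕ) (la lb : ℤ) (ft t10 : List (List Iv)) (e1 e2 r1 r2 : ℕ) : Iv :=
  if e1 = 1 ∧ e2 = 0 then getF t10 r1 r2 else dIv2 L la lb ft e1 e2 r1 r2

/-- the oracle of the cell with the single gradient table the convolution form needs. [folklore] -/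
def cellOracle1 (L : ℕ) (la lb : ℤ) : ℕ → ℕ → ℕ → ℕ → Iv :=
  dOracle1 L la lb (fTab L la lb) (gTab L la lb (fTab L la lb) 1 0)

/-! ## Soundness of the row dot product -/

variable {L}

omit [NeZero L] in
/-- the dot product encloses `Σ_{j<n} g j · h j` for rows of length `n` enclosing `g`, `h` entrywise. [folklore] -/
theorem mem_dot : ∀ (l1 l2 : List Iv) (g h : ℕ → ℝ), l1.length = l2.length →
    (∀ j : ℕ, j < l1.length → mem (g j) (getIv l1 j)) → (∀ j : ℕ, j < l2.length → mem (h j) (getIv l2 j)) →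
    mem (∑ j ∈ range l1.length, g j * h j) (dot l1 l2)
  | [], [], g, h, _, _, _ => by
      simp only [List.length_nil, Finset.range_zero, Finset.sum_empty, dot, mem, Int.cast_zero, zero_mul, le_refl,
        and_self]
  | [], _ :: _, g, h, hlen, _, _ => by simp at hlen
  | _ :: _, [], g, h, hlen, _, _ => by simp at hlen
  | a :: as, b :: bs, g, h, hlen, hg, hh => by
      simp only [List.length_cons] at hlen hg hh ⊢
      rw [Finset.sum_range_succ', dot]
      rw [add_comm]
      refine mem_iadd ?_ ?_
      · have h0g := hg 0 (by omega)
        have h0h := hh 0 (by omega)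
        simp only [getIv, List.getD_cons_zero] at h0g h0h
        exact mem_imul h0g h0h
      · refine mem_dot as bs (fun j => g (j + 1)) (fun j => h (j + 1)) (by omega) (fun j hj => ?_) (fun j hj => ?_)
        · have := hg (j + 1) (by omega)
          simpa only [getIv, List.getD_cons_succ] using this
        · have := hh (j + 1) (by omega)
          simpa only [getIv, List.getD_cons_succ] using this

omit [NeZero L] in
/-- rows of `mkTab`. [folklore] -/
theorem mkTab_row (g : ℕ → ℕ → Iv) {r1 : ℕ} (hr1 : r1 < L) :
    (mkTab L g).getD r1 [] = (List.range L).map (g r1) := by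
  unfold mkTab
  exact getD_map_range _ _ hr1

omit [NeZero L] in
/-- entries of `mkTab`. [folklore] -/
theorem getF_mkTab (g : ℕ → ℕ → Iv) {r1 r2 : ℕ} (hr1 : r1 < L) (hr2 : r2 < L) :
    getF (mkTab L g) r1 r2 = g r1 r2 := by
  unfold getF mkTab
  exact getIv_tab g hr1 hr2

omit [NeZero L] in
/-- entries of a rotated table row: `(row.rotate (L − x₂))[j] = g(subm L j x₂)`. [folklore] -/
theorem getIv_rotate_row (g : ℕ → Iv) {x2 j : ℕ} (hx2 : x2 < L) (hj : j < L) :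
    getIv (((List.range L).map g).rotate (L - x2)) j = g (subm L j x2) := by
  have hlen : (((List.range L).map g).rotate (L - x2)).length = L := by
    rw [List.length_rotate, List.length_map, List.length_range]
  unfold getIv
  rw [List.getD_eq_getElem _ _ (by rw [hlen]; exact hj), List.getElem_rotate]
  simp only [List.length_map, List.length_range, List.getElem_map, List.getElem_range]
  unfold subm
  congr 1
  rw [Nat.add_sub_assoc hx2.le]

omit [NeZero L] in
/-- ★ the inner row sum is enclosed. [folklore] -/
theorem mem_rowConv (gp gF : ℕ → ℕ → Iv) (pv Fv : ℕ → ℕ → ℝ)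
    (hp : ∀ r1 r2 : ℕ, r1 < L → r2 < L → mem (pv r1 r2) (gp r1 r2))
    (hF : ∀ r1 r2 : ℕ, r1 < L → r2 < L → mem (Fv r1 r2) (gF r1 r2))
    {x1 x2 y1 : ℕ} (hx2 : x2 < L) (hy1 : y1 < L) :
    mem (∑ y2 ∈ range L, pv y1 y2 * Fv (subm L y1 x1) (subm L y2 x2))
      (rowConv L (mkTab L gp) (mkTab L gF) x1 x2 y1) := by
  have hL : 0 < L := by omega
  have hs1 := subm_lt L y1 x1 hL
  unfold rowConv
  rw [mkTab_row gp hy1, mkTab_row gF hs1]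
  have hl1 : ((List.range L).map (gp y1)).length = L := by rw [List.length_map, List.length_range]
  have hl2 : (((List.range L).map (gF (subm L y1 x1))).rotate (L - x2)).length = L := by
    rw [List.length_rotate, List.length_map, List.length_range]
  have := mem_dot ((List.range L).map (gp y1)) (((List.range L).map (gF (subm L y1 x1))).rotate (L - x2))
    (fun y2 => pv y1 y2) (fun y2 => Fv (subm L y1 x1) (subm L y2 x2)) (by rw [hl1, hl2])
    (fun j hj => by
      rw [hl1] at hj
      unfold getIv
      rw [getD_map_range _ _ hj]
      exact hp y1 j hy1 hj)
    (fun j hj => by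
      rw [hl2] at hj
      rw [getIv_rotate_row _ hx2 hj]
      exact hF _ _ hs1 (subm_lt L j x2 hL))
  rw [hl1] at this
  exact this

/-- ★ the convolution triple is enclosed: `Σ_x φ(x) Σ_y φ(y) F(y−x) ∈ convIv` for tables enclosing `φ` and `F`. [folklore] -/
theorem mem_convIv {φ F : Tor L → ℝ} (gp gF : ℕ → ℕ → Iv)
    (hp : ∀ r1 r2 : ℕ, r1 < L → r2 < L → mem (φ ((((r1 : ℕ) : ZMod L)), (((r2 : ℕ) : ZMod L)))) (gp r1 r2))
    (hF : ∀ r1 r2 : ℕ, r1 < L → r2 < L → mem (F ((((r1 : ℕ) : ZMod L)), (((r2 : ℕ) : ZMod L)))) (gF r1 r2)) :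
    mem (∑ x : Tor L, ∑ y : Tor L, φ x * φ y * F (y - x)) (convIv L (mkTab L gp) (mkTab L gF)) := by
  have hmul : ∀ x : Tor L, ∑ y : Tor L, φ x * φ y * F (y - x) = φ x * ∑ y : Tor L, φ y * F (y - x) := by
    intro x
    rw [Finset.mul_sum]
    exact Finset.sum_congr rfl fun y _ => by ring
  simp_rw [hmul]
  rw [sum_tor_range]
  unfold convIv
  refine mem_psum _ _ L fun x1 hx1 => ?_
  refine mem_psum _ _ L fun x2 hx2 => ?_
  rw [getF_mkTab gp hx1 hx2]
  refine mem_imul (hp x1 x2 hx1 hx2) ?_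
  rw [sum_tor_range]
  refine mem_psum _ _ L fun y1 hy1 => ?_
  have hco : ∀ y2 : ℕ, y2 ∈ range L →
      φ ((((y1 : ℕ) : ZMod L)), (((y2 : ℕ) : ZMod L)))
          * F (((((y1 : ℕ) : ZMod L)), (((y2 : ℕ) : ZMod L))) - ((((x1 : ℕ) : ZMod L)), (((x2 : ℕ) : ZMod L))))
        = (fun r1 r2 : ℕ => φ ((((r1 : ℕ) : ZMod L)), (((r2 : ℕ) : ZMod L)))) y1 y2
          * (fun r1 r2 : ℕ => F ((((r1 : ℕ) : ZMod L)), (((r2 : ℕ) : ZMod L)))) (subm L y1 x1) (subm L y2 x2) := by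
    intro y2 _
    simp only
    rw [pt_sub x1 x2 y1 y2 hx1 hx2]
  rw [Finset.sum_congr rfl hco]
  exact mem_rowConv gp gF _ _ hp hF hx2 hy1

/-! ## The folding identities -/

/-- the opposite direction folds onto `e`: `Σ φ_{−e}(x)φ_{−e}(y)f(y−x)² = Σ φ_e(x)φ_e(y)f(y−x)²` (even `f`). [folklore] -/
theorem conv_fold_neg {f : Tor L → ℝ} (hev : ∀ r : Tor L, f (-r) = f r) (e : Tor L) :
    ∑ x : Tor L, ∑ y : Tor L, (f x * Dgrad L f (-e) x) * (f y * Dgrad L f (-e) y) * f (y - x) ^ 2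
      = ∑ x : Tor L, ∑ y : Tor L, (f x * Dgrad L f e x) * (f y * Dgrad L f e y) * f (y - x) ^ 2 := by
  simp_rw [← hfun_neg L hev e]
  rw [← Equiv.sum_comp (Equiv.neg (Tor L))]
  refine Finset.sum_congr rfl fun x _ => ?_
  rw [← Equiv.sum_comp (Equiv.neg (Tor L))]
  refine Finset.sum_congr rfl fun y _ => ?_
  simp only [Equiv.neg_apply, neg_neg]
  rw [show -y - -x = -(y - x) by abel, hev]

/-- the `ey` direction folds onto `ex` for a swap-symmetric `f`. [folklore] -/
theorem conv_fold_swap {f : Tor L → ℝ} (hsw : ∀ r : Tor L, f (r.2, r.1) = f r) :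
    ∑ x : Tor L, ∑ y : Tor L, (f x * Dgrad L f (ey L) x) * (f y * Dgrad L f (ey L) y) * f (y - x) ^ 2
      = ∑ x : Tor L, ∑ y : Tor L, (f x * Dgrad L f (ex L) x) * (f y * Dgrad L f (ex L) y) * f (y - x) ^ 2 := by
  have hphi : ∀ x : Tor L, f x * Dgrad L f (ey L) x = f (x.2, x.1) * Dgrad L f (ex L) (x.2, x.1) := by
    intro x
    unfold Dgrad ex ey
    rw [hsw x, ← hsw (x - (0, 1))]
    rfl
  simp_rw [hphi]
  rw [← Equiv.sum_comp (Equiv.prodComm (ZMod L) (ZMod L))]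
  refine Finset.sum_congr rfl fun x _ => ?_
  rw [← Equiv.sum_comp (Equiv.prodComm (ZMod L) (ZMod L))]
  refine Finset.sum_congr rfl fun y _ => ?_
  simp only [Equiv.prodComm_apply, Prod.swap]
  rw [← hsw ((y.2, y.1) - (x.2, x.1))]
  rfl

/-- ★ THE CONVOLUTION FORM OF THE CROSS SUM: `Σ_c Π⁰·C0fn = −6 Σ_x Σ_y φ(x)φ(y)f(y−x)²`, `φ = f·D_{ex} f`, for an even,
swap-symmetric two-magnon profile. [folklore] -/
theorem sum_piR_C0fn_conv {Δ lam2 : ℝ} {f : Tor L → ℝ} (hf : IsTwoMagnon L Δ lam2 f)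
    (hev : ∀ r : Tor L, f (-r) = f r) (hsw : ∀ r : Tor L, f (r.2, r.1) = f r) :
    ∑ c : Cfg L, piR L f c * C0fn L Δ lam2 f c
      = -6 * ∑ x : Tor L, ∑ y : Tor L, (f x * Dgrad L f (ex L) x) * (f y * Dgrad L f (ex L) y) * f (y - x) ^ 2 := by
  have key : ∀ e : Tor L, ∑ c : Cfg L, piR L f c * crossT L f e c
      = 3 * ∑ x : Tor L, ∑ y : Tor L, (f x * Dgrad L f e x) * (f y * Dgrad L f e y) * f (y - x) ^ 2 := by
    intro e
    have := cross_sum_w L (fun _ _ => (1 : ℝ)) (fun _ _ => rfl) (fun _ _ => rfl) hev e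
    simp only [one_mul] at this
    exact this
  rw [Finset.sum_congr rfl (fun c _ => piR_mul_C0fn L hf c)]
  simp_rw [nnList_map_sum]
  have hs : ∑ c : Cfg L, -(1 / 2) * (piR L f c * (crossT L f (ex L) c + crossT L f (-ex L) c + crossT L f (ey L) c
      + crossT L f (-ey L) c))
      = -(1 / 2) * (∑ c : Cfg L, piR L f c * crossT L f (ex L) c + ∑ c : Cfg L, piR L f c * crossT L f (-ex L) c
          + ∑ c : Cfg L, piR L f c * crossT L f (ey L) c + ∑ c : Cfg L, piR L f c * crossT L f (-ey L) c) := by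
    rw [← Finset.sum_add_distrib, ← Finset.sum_add_distrib, ← Finset.sum_add_distrib, ← Finset.mul_sum]
    congr 1
    refine Finset.sum_congr rfl fun c _ => ?_
    ring
  rw [hs, key, key, key, key, conv_fold_neg hev (ex L), conv_fold_neg hev (ey L), conv_fold_swap hsw]
  ring

/-- ★ `‖Π⁰‖² = Σ_x F(x) Σ_y F(y) F(y−x)`, `F = f²`. [folklore] -/
theorem piNormSq_conv (f : Tor L → ℝ) :
    PiNormSq L f = ∑ x : Tor L, ∑ y : Tor L, f x ^ 2 * f y ^ 2 * f (y - x) ^ 2 := by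
  unfold PiNormSq piR
  rw [Fintype.sum_prod_type]
  exact Finset.sum_congr rfl fun x _ => Finset.sum_congr rfl fun y _ => by ring

/-- the explicit ground profile is swap-symmetric. [folklore] -/
theorem groundF_swap (lam : ℝ) (r : Tor L) : groundF L lam (r.2, r.1) = groundF L lam r := by
  unfold groundF aKer
  have h0 : ((r.2, r.1) : Tor L) = 0 ↔ r = 0 := by
    rw [Prod.mk_eq_zero, Prod.ext_iff]
    exact ⟨fun h => ⟨h.2, h.1⟩, fun h => ⟨h.2, h.1⟩⟩
  by_cases hr : r = 0
  · rw [if_pos (h0.mpr hr), if_pos hr]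
  · rw [if_neg (fun h => hr (h0.mp h)), if_neg hr, Gres_swap]

/-! ## Soundness of `SIv3`, `NIv3`, `cellOracle1` -/

/-- ★ `Σ_c Π⁰·C0fn ∈ SIv3` for an even swap-symmetric two-magnon profile, an enclosing table and a sound gradient oracle. [folklore] -/
theorem mem_SIv3 (hL : 2 ≤ L) {Δ lam2 : ℝ} {f : Tor L → ℝ} (hf : IsTwoMagnon L Δ lam2 f)
    (hev : ∀ r : Tor L, f (-r) = f r) (hsw : ∀ r : Tor L, f (r.2, r.1) = f r)
    {ft : List (List Iv)} (hft : TabEncl L f ft) {dF : ℕ → ℕ → ℕ → ℕ → Iv}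
    (hdF : ∀ e1 e2 r1 r2 : ℕ, e1 < L → e2 < L → r1 < L → r2 < L →
      mem (Dgrad L f ((((e1 : ℕ) : ZMod L)), (((e2 : ℕ) : ZMod L))) ((((r1 : ℕ) : ZMod L)), (((r2 : ℕ) : ZMod L))))
        (dF e1 e2 r1 r2)) :
    mem (∑ c : Cfg L, piR L f c * C0fn L Δ lam2 f c) (SIv3 L ft dF) := by
  rw [sum_piR_C0fn_conv hf hev hsw, show ∀ t : ℝ, -6 * t = -(((6 : ℕ) : ℝ) * t) from fun t => by push_cast; ring]
  unfold SIv3 phiTab fsqTab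
  refine mem_ineg (mem_iscale 6 (mem_convIv (φ := fun r => f r * Dgrad L f (ex L) r) (F := fun r => f r ^ 2) _ _
    (fun r1 r2 hr1 hr2 => ?_) (fun r1 r2 hr1 hr2 => ?_)))
  · rw [(dirs_natCast hL).1]
    exact mem_imul (hft r1 r2 hr1 hr2) (hdF 1 0 r1 r2 (by omega) (by omega) hr1 hr2)
  · rw [sq]
    exact mem_imul (hft r1 r2 hr1 hr2) (hft r1 r2 hr1 hr2)

/-- ★ `‖Π⁰‖² ∈ NIv3` for any enclosing table. [folklore] -/
theorem mem_NIv3 {f : Tor L → ℝ} {ft : List (List Iv)} (hft : TabEncl L f ft) :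
    mem (PiNormSq L f) (NIv3 L ft) := by
  rw [piNormSq_conv]
  unfold NIv3 fsqTab
  refine mem_convIv (φ := fun r => f r ^ 2) (F := fun r => f r ^ 2) _ _
    (fun r1 r2 hr1 hr2 => ?_) (fun r1 r2 hr1 hr2 => ?_)
  · rw [sq]
    exact mem_imul (hft r1 r2 hr1 hr2) (hft r1 r2 hr1 hr2)
  · rw [sq]
    exact mem_imul (hft r1 r2 hr1 hr2) (hft r1 r2 hr1 hr2)

/-- ★ the one-direction cell oracle encloses `D_e (groundF L λ)` for every direction given by natural coordinates `< L`. [folklore] -/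
theorem mem_cellOracle1 (hL : 3 ≤ L) {lam : ℝ} (hlam : 0 < lam) {la lb : ℤ}
    (hla : (la : ℝ) ≤ lam * ((D : ℤ) : ℝ)) (hlb : lam * ((D : ℤ) : ℝ) ≤ (lb : ℝ))
    (hchk : groundCellCheck L la lb = true) :
    ∀ e1 e2 r1 r2 : ℕ, e1 < L → e2 < L → r1 < L → r2 < L →
      mem (Dgrad L (groundF L lam) ((((e1 : ℕ) : ZMod L)), (((e2 : ℕ) : ZMod L)))
          ((((r1 : ℕ) : ZMod L)), (((r2 : ℕ) : ZMod L))))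
        (cellOracle1 L la lb e1 e2 r1 r2) := by
  intro e1 e2 r1 r2 he1 he2 hr1 hr2
  unfold cellOracle1 dOracle1
  split_ifs with h1
  · obtain ⟨rfl, rfl⟩ := h1
    have key : getF (gTab L la lb (fTab L la lb) 1 0) r1 r2 = dIv2 L la lb (fTab L la lb) 1 0 r1 r2 := by
      unfold getF gTab
      exact getIv_tab (fun x y => dIv2 L la lb (fTab L la lb) 1 0 x y) hr1 hr2
    rw [key]
    exact mem_dIv2 hL hlam hla hlb hchk he1 he2 hr1 hr2
  · exact mem_dIv2 hL hlam hla hlb hchk he1 he2 hr1 hr2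

end FinCell

end Summit.HubbardSuperconductivity.HubbardSuperconductivity.Theorems.AnisotropyChord.Transfer.Fibre3

end
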